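import Literature.AlgebraicGeometry.Hu2025.Proofs.S01S09Interface.GammaQuadHu22SetupTorsor
import Literature.AlgebraicGeometry.Hu2025.Proofs.S01S09Interface.GammaQuadTorusFree
import Literature.AlgebraicGeometry.Hu2025.Proofs.S01S09Interface.SplitTorusOverAPI
import Literature.AlgebraicGeometry.Hu2025.Proofs.S03Pluecker.GammaQuadSliceRational
import HarnessLib

/-!
# Hu 2022 p.131, reading (β) — a KERNEL INHABITANT of row 110 h `Hu22Setup_printed_ours L ℚ 9 d_quad` (ALL printed Thm-9.4
# data: `X := Spec ℚ` integral, «positive integer `r`» `= 6`, `U := D(Δ6) ⊂ 𝔸⁶` open ≅ `Gr̄_d`, the torus FREE, the quotient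
# map `π` a trivial `𝔾⁸_m`-torsor in the typed (9.4) shape, `cell` = the Prop-9.1 locus) for which the sentence p.131 l.40–41
# FAILS: `¬ Hu22P131L40_printed_ours` (joint J1 / GAP-LEDGER-HU row HU-R01 — OURS; nothing of the sources asserted)

**HONEST FRAMING (D-0012/D-0089).** [Hu2025] (arXiv:2507.21400v1) / [Hu2022] (arXiv:2203.03842v4) are unrefereed preprints under
adjudication; nothing of them is asserted. This file assembles, for `d = quad` at `𝔽 = ℚ`, the datum the M-Hu LEAD's (β) word of
2026-08-27T10:40:07Z described by hand («X := a point, r := 6, U := the open of 𝔸⁶ ≅ Gr̄_quad, π globally trivial via the slice,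
cell = the Prop-9.1 locus, torus free; Z_{Γ_quad} not integral»), as an inhabitant of res-type-024's OURS printed-setting record h
(`R110hSetupPrintedOurs`, p525500) following res-type-024's recipe and API (`SplitTorusOverAPI`, p528603):
`X := Spec ℚ`, `r := 6`, `U := D(Δ6) ⊂ 𝔸(Fin 6; Spec ℚ)` (`SplitTorusOver.basicOpenSpecIso`) with `U ≅ Spec ℚ[y][1/Δ6] ≅ Spec (Rh ⧸ J)
= Gr̄_quad` (`QuadTorus.sliceRationalEquiv`, `S03Pluecker/GammaQuadSliceRational`), `cell := Lit.cellScheme`, `quot := Spec` of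
`ℚ[y][1/Δ6] ≅ Rh ⧸ J →πJ Rh ≅ CellRing` (the torus normalisation in the rational coordinates), `hfree :=
TorusFree.torusFreeOnCell_quadHuMatroid`, `quot_trivialises` from `SplitTorusOver.trivialises_of_affine` applied to the ring
isomorphism `CellRing ≅ ℚ[y][1/Δ6][s₁..s₈][1/∏ s]` (`QuadTorus.torsorEquiv` transported along `sliceRationalEquiv`), `isoBarGr`
NOMINAL (`L_quad.barGr := U`, as g/h disclose for the unconstructed [La03] objects). MAIN: `S_printed6 : Hu22Setup_printed_ours L_quad ℚ 9
quadHuMatroid`, `IsIntegral S_printed6.X`, **`not_Hu22P131L40_printed_ours_6 : ¬ Hu22P131L40_printed_ours S_printed6`**.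
NOT met (cannot be, at ℚ — `PrintedSettingRatEmpty` p526634): g's literal `X_thm94` (X of finite type over Spec ℤ); and «`d` = Lafforgue's
encoding of `X`» stays untyped. OURS kernel statements about the typed records; they bear on ONE inference (p.131 l.40–41), not on
[Hu25] Thm 1.3/1.1. AI proof is weaker than expert review.
-/

noncomputable section

open _root_.CategoryTheory _root_.AlgebraicGeometry

namespace Literature.AlgebraicGeometry.Hu2025.Statements.S01S09Interface

namespace Torus6

open S03Pluecker S07GammaSchemes S08MainTheorem QuadTorus

/-! ## The base `X := Spec ℚ`, the open `U := D(Δ6) ⊂ 𝔸⁶` and the rings -/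

/-- `ℚ` as a bundled ring. OURS abbreviation.
[cite: Hu2025, Thm. 9.4 p.161; [Hu22] p.131 l.4–9; joint J1 = GAP-LEDGER-HU row HU-R01 (unrefereed preprints under adjudication, D-0012/D-0089 — kernel statement about OUR typed records of rows 101/110; nothing of the sources asserted)] -/
abbrev Qr : CommRingCat.{0} := CommRingCat.of ℚ

/-- **`X := Spec ℚ`** (a point; integral). OURS.
[cite: Hu2025, Thm. 9.4 p.161; [Hu22] p.131 l.4–9; joint J1 = GAP-LEDGER-HU row HU-R01 (unrefereed preprints under adjudication, D-0012/D-0089 — kernel statement about OUR typed records; nothing of the sources asserted)] -/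
abbrev Xpt : Scheme.{0} := Spec Qr

/-- **`U := D(Δ6) ⊂ 𝔸(Fin 6; Spec ℚ)`** — the open of `𝔸⁶` isomorphic to `Gr̄_quad`. OURS.
[cite: Hu2025, Thm. 9.4 («a positive integer r and an open subset U ⊂ X × 𝔸^r … isomorphic to Gr̄_d») p.161; [Hu22] p.130 l.45–50; joint J1 = GAP-LEDGER-HU row HU-R01 (unrefereed preprints under adjudication, D-0012/D-0089 — kernel statement about OUR typed records; nothing of the sources asserted)] -/
def U6 : (𝔸(Fin 6; Xpt)).Opens := (𝔸(Fin 6; Xpt)).basicOpen (SplitTorusOver.polySection (R := Qr) (Δ6 ℚ))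

/-- `U ≅ Spec ℚ[y][1/Δ6]` (res-type-024's `basicOpenSpecIso`). OURS plumbing.
[cite: Hu2025, Thm. 9.4 p.161; joint J1 = GAP-LEDGER-HU row HU-R01 (unrefereed preprints under adjudication, D-0012/D-0089 — kernel statement about OUR typed records; nothing of the sources asserted)] -/
def uIso : (U6 : Scheme.{0}) ≅ Spec (CommRingCat.of (B6 ℚ)) := SplitTorusOver.basicOpenSpecIso (R := Qr) (Δ6 ℚ)

/-- **The quotient map at ring level in rational coordinates**: `ℚ[y][1/Δ6] ≅ Rh ⧸ J →πJ Rh ≅ CellRing`. OURS.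
[cite: Hu2025, Thm. 9.4 p.161; [Hu22] p.131 l.10–16 («the quotient map π»); joint J1 = GAP-LEDGER-HU row HU-R01 (unrefereed preprints under adjudication, D-0012/D-0089 — kernel statement about OUR typed records; nothing of the sources asserted)] -/
def φ6 : B6 ℚ →+* Lit.CellRing :=
  Torus.cellRingEquiv.symm.toRingHom.comp ((πJ ℚ).comp (sliceRationalEquiv ℚ).symm.toRingHom)

/-- **`quot`**: `cell ⟶ U`, the torus normalisation followed by the rational coordinates. OURS.
[cite: Hu2025, Thm. 9.4 p.161; [Hu22] p.131 l.10–16, diagram (9.2); joint J1 = GAP-LEDGER-HU row HU-R01 (unrefereed preprints under adjudication, D-0012/D-0089 — kernel statement about OUR typed records; nothing of the sources asserted)] -/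
def quot6 : Lit.cellScheme ⟶ (U6 : Scheme.{0}) := Spec.map (CommRingCat.ofHom φ6) ≫ uIso.inv

/-- A left inverse of `φ6`: `CellRing ≅ Rh → Rh ⧸ J ≅ ℚ[y][1/Δ6]` (the slice section in rational coordinates). OURS.
[cite: Hu2025, Thm. 9.4 p.161; [Hu22] p.131 l.10–16; joint J1 = GAP-LEDGER-HU row HU-R01 (unrefereed preprints under adjudication, D-0012/D-0089 — kernel statement about OUR typed records; nothing of the sources asserted)] -/
def σ6 : Lit.CellRing →+* B6 ℚ :=
  (sliceRationalEquiv ℚ).toRingHom.comp ((Ideal.Quotient.mk (J ℚ)).comp Torus.cellRingEquiv.toRingHom)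

/-- `σ6 ∘ φ6 = id`.
[cite: Hu2025, Thm. 9.4 p.161; [Hu22] p.131 l.10–16; joint J1 = GAP-LEDGER-HU row HU-R01 (unrefereed preprints under adjudication, D-0012/D-0089 — kernel statement about OUR typed records; nothing of the sources asserted)] -/
theorem σ6_comp_φ6 : σ6.comp φ6 = RingHom.id (B6 ℚ) := by
  refine RingHom.ext fun b => ?_
  have hGF : G ℚ (F ℚ b) = b := by
    have := congrFun (congrArg DFunLike.coe (G_comp_F ℚ)) b
    simpa using this
  have hsec : Ideal.Quotient.mk (J ℚ) (πJ ℚ (F ℚ b)) = F ℚ b := by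
    have := congrFun (congrArg DFunLike.coe (mk_comp_πJ ℚ)) (F ℚ b)
    simpa using this
  simp only [σ6, φ6, RingHom.comp_apply, RingHom.id_apply, RingEquiv.toRingHom_eq_coe, RingEquiv.coe_toRingHom,
    RingEquiv.apply_symm_apply]
  show sliceRationalEquiv ℚ (Ideal.Quotient.mk (J ℚ) (πJ ℚ ((sliceRationalEquiv ℚ).symm b))) = b
  have eF : (sliceRationalEquiv ℚ).symm b = F ℚ b := rfl
  rw [eF, hsec, sliceRationalEquiv_apply, hGF]

/-- `Spec φ6` is surjective (it has the section `Spec σ6`).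
[cite: Hu2025, [Hu22] p.131 l.17–26 (diagram (9.2), `Gr_d ↠ Gr̄_d`); joint J1 = GAP-LEDGER-HU row HU-R01 (unrefereed preprints under adjudication, D-0012/D-0089 — kernel statement about OUR typed records; nothing of the sources asserted)] -/
instance surjective_specφ6 : Surjective (Spec.map (CommRingCat.ofHom φ6)) := by
  have hs : Spec.map (CommRingCat.ofHom σ6) ≫ Spec.map (CommRingCat.ofHom φ6) = 𝟙 _ := by
    rw [← Spec.map_comp, ← CommRingCat.ofHom_comp, σ6_comp_φ6, CommRingCat.ofHom_id, Spec.map_id]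
  exact ⟨fun x => ⟨Spec.map (CommRingCat.ofHom σ6) x, by rw [← Scheme.Hom.comp_apply, hs]; rfl⟩⟩

/-- `quot6` is surjective.
[cite: Hu2025, [Hu22] p.131 l.17–26 (diagram (9.2), `Gr_d ↠ Gr̄_d`); joint J1 = GAP-LEDGER-HU row HU-R01 (unrefereed preprints under adjudication, D-0012/D-0089 — kernel statement about OUR typed records; nothing of the sources asserted)] -/
instance surjective_quot6 : Surjective quot6 := by
  have h1 : Function.Surjective ⇑(Spec.map (CommRingCat.ofHom φ6)) := surjective_specφ6.surj
  have h2 : Function.Surjective ⇑uIso.inv := fun x =>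
    ⟨uIso.hom x, by rw [← Scheme.Hom.comp_apply, Iso.hom_inv_id]; rfl⟩
  refine ⟨fun x => ?_⟩
  obtain ⟨y, hy⟩ := h2 x
  obtain ⟨z, hz⟩ := h1 y
  exact ⟨z, by rw [quot6, Scheme.Hom.comp_apply]; exact (congrArg (fun w => uIso.inv w) hz).trans hy⟩

/-- `ℚ[y][1/Δ6]` is a domain (it is `≅ Rh ⧸ J`).
[cite: Hu2025, Thm. 9.4 p.161; joint J1 = GAP-LEDGER-HU row HU-R01 (unrefereed preprints under adjudication, D-0012/D-0089 — kernel statement about OUR typed records; nothing of the sources asserted)] -/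
instance isDomain_B6 : IsDomain (B6 ℚ) := by
  haveI : IsDomain (Slice ℚ) := isDomain_slice ℚ
  exact (sliceRationalEquiv ℚ).symm.toMulEquiv.isDomain

/-- `U` is non-empty.
[cite: Hu2025, Thm. 9.4 p.161; joint J1 = GAP-LEDGER-HU row HU-R01 (unrefereed preprints under adjudication, D-0012/D-0089 — kernel statement about OUR typed records; nothing of the sources asserted)] -/
instance nonempty_U6 : Nonempty (U6 : Scheme.{0}) :=
  ⟨uIso.inv (Classical.arbitrary (Spec (CommRingCat.of (B6 ℚ))))⟩

/-- `U ↠ X = Spec ℚ` («projecting onto `X`»): `Spec ℚ` is a point and `U` is non-empty.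
[cite: Hu2025, Thm. 9.4 («an open subset U ⊂ X × 𝔸^r projecting onto X») p.161; [Hu22] p.130 l.45–50; joint J1 = GAP-LEDGER-HU row HU-R01 (unrefereed preprints under adjudication, D-0012/D-0089 — kernel statement about OUR typed records; nothing of the sources asserted)] -/
instance surjective_U6_over : Surjective (U6.ι ≫ (𝔸(Fin 6; Xpt) ↘ Xpt)) :=
  ⟨fun _ => ⟨Classical.arbitrary _, Subsingleton.elim (α := PrimeSpectrum ℚ) _ _⟩⟩

/-! ## The torsor structure in rational coordinates: `CellRing ≅ ℚ[y][1/Δ6][s₁..s₈][1/∏ s]` -/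

/-- Transport of coefficients `Rh ⧸ J ≅ ℚ[y][1/Δ6]` on the polynomial rings in the torus variables. OURS plumbing.
[cite: Hu2025, Thm. 9.4 p.161; [Hu22] p.132 l.43–51; joint J1 = GAP-LEDGER-HU row HU-R01 (unrefereed preprints under adjudication, D-0012/D-0089 — kernel statement about OUR typed records; nothing of the sources asserted)] -/
def polyEquiv : SlicePoly ℚ ≃+* MvPolynomial (Fin 8) (B6 ℚ) := MvPolynomial.mapEquiv (Fin 8) (sliceRationalEquiv ℚ)

/-- The torus-variable product is preserved.
[cite: Hu2025, Thm. 9.4 p.161; [Hu22] p.132 l.43–51; joint J1 = GAP-LEDGER-HU row HU-R01 (unrefereed preprints under adjudication, D-0012/D-0089 — kernel statement about OUR typed records; nothing of the sources asserted)] -/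
theorem polyEquiv_tProd : polyEquiv (tProd ℚ) = SplitTorusOver.coordProd 8 (B6 ℚ) := by
  rw [polyEquiv, MvPolynomial.mapEquiv_apply, tProd, map_prod]
  exact Finset.prod_congr rfl fun i _ => MvPolynomial.map_X _ i

/-- The localising submonoids correspond.
[cite: Hu2025, Thm. 9.4 p.161; joint J1 = GAP-LEDGER-HU row HU-R01 (unrefereed preprints under adjudication, D-0012/D-0089 — kernel statement about OUR typed records; nothing of the sources asserted)] -/
theorem powers_map_polyEquiv :
    (Submonoid.powers (tProd ℚ)).map polyEquiv.toMonoidHom = Submonoid.powers (SplitTorusOver.coordProd 8 (B6 ℚ)) := by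
  rw [Submonoid.map_powers]; exact congrArg Submonoid.powers polyEquiv_tProd

/-- `(Rh ⧸ J)[s^±] ≅ ℚ[y][1/Δ6][s^±]`. OURS plumbing.
[cite: Hu2025, Thm. 9.4 p.161; [Hu22] p.132 l.43–51; joint J1 = GAP-LEDGER-HU row HU-R01 (unrefereed preprints under adjudication, D-0012/D-0089 — kernel statement about OUR typed records; nothing of the sources asserted)] -/
def lawEquiv : LaurentSlice ℚ ≃+* Localization.Away (SplitTorusOver.coordProd 8 (B6 ℚ)) :=
  IsLocalization.ringEquivOfRingEquiv (LaurentSlice ℚ) (Localization.Away (SplitTorusOver.coordProd 8 (B6 ℚ))) polyEquiv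
    powers_map_polyEquiv

/-- **`ψ6 : CellRing ≅ ℚ[y][1/Δ6][s₁..s₈][1/∏ s]`** — the torsor isomorphism in rational coordinates. OURS.
[cite: Hu2025, Thm. 9.4 p.161; [Hu22] p.132 l.43–51 («(9.4) Gr_d|_O ≅ O × (𝔾ⁿ_m/𝔾_m) … 𝔾^{n−1}_m = Spec 𝔽[s^±]»); joint J1 = GAP-LEDGER-HU row HU-R01 (unrefereed preprints under adjudication, D-0012/D-0089 — kernel statement about OUR typed records; nothing of the sources asserted)] -/
def ψ6 : Lit.CellRing ≃+* Localization.Away (SplitTorusOver.coordProd 8 (B6 ℚ)) :=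
  (Torus.cellRingEquiv.trans (torsorEquiv ℚ)).trans lawEquiv

/-- **Compatibility `ψ6 ∘ φ6 = algebraMap`**: in the coordinates `(y, s)` the quotient map is the projection.
[cite: Hu2025, Thm. 9.4 p.161; [Hu22] p.131 l.10–16, p.132 l.43–51; joint J1 = GAP-LEDGER-HU row HU-R01 (unrefereed preprints under adjudication, D-0012/D-0089 — kernel statement about OUR typed records; nothing of the sources asserted)] -/
theorem ψ6_φ6 (b : B6 ℚ) : ψ6 (φ6 b) = algebraMap (B6 ℚ) (Localization.Away (SplitTorusOver.coordProd 8 (B6 ℚ))) b := by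
  have hGF : G ℚ (F ℚ b) = b := by
    have := congrFun (congrArg DFunLike.coe (G_comp_F ℚ)) b
    simpa using this
  rw [φ6, ψ6]
  simp only [RingHom.comp_apply, RingEquiv.toRingHom_eq_coe, RingEquiv.coe_toRingHom, RingEquiv.trans_apply,
    RingEquiv.apply_symm_apply]
  show lawEquiv (torsorEquiv ℚ (πJ ℚ (F ℚ b))) = _
  rw [torsorEquiv_πJ, ιL, RingHom.comp_apply, lawEquiv, IsLocalization.ringEquivOfRingEquiv_eq, polyEquiv,
    MvPolynomial.mapEquiv_apply, MvPolynomial.map_C, RingEquiv.coe_toRingHom, sliceRationalEquiv_apply, hGF,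
    IsScalarTower.algebraMap_apply (B6 ℚ) (MvPolynomial (Fin 8) (B6 ℚ)) (Localization.Away _), MvPolynomial.algebraMap_eq]

/-- `φ6 ≫ ψ6 = algebraMap` as morphisms of `CommRingCat`.
[cite: Hu2025, Thm. 9.4 p.161; [Hu22] p.132 l.43–51; joint J1 = GAP-LEDGER-HU row HU-R01 (unrefereed preprints under adjudication, D-0012/D-0089 — kernel statement about OUR typed records; nothing of the sources asserted)] -/
theorem hψ6 : CommRingCat.ofHom φ6 ≫ ψ6.toCommRingCatIso.hom =
    CommRingCat.ofHom (algebraMap (B6 ℚ) (Localization.Away (SplitTorusOver.coordProd 8 (B6 ℚ)))) := by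
  ext b
  exact ψ6_φ6 b

/-- **The quotient map trivialises** ((9.4) in row 110 g/h's typed shape `SplitTorusOver.Trivialises 8 quot6`, cover {⊤}).
[cite: Hu2025, Thm. 9.4 p.161; [Hu22] p.132 l.30–51 («π … is a principal (𝔾ⁿ_m/𝔾_m)-bundle … (9.4) Gr_d|_O ≅ O × (𝔾ⁿ_m/𝔾_m)»); joint J1 = GAP-LEDGER-HU row HU-R01 (unrefereed preprints under adjudication, D-0012/D-0089 — kernel statement about OUR typed records; nothing of the sources asserted)] -/
theorem trivialises_quot6 : SplitTorusOver.Trivialises 8 quot6 := by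
  refine SplitTorusOver.trivialises_of_comp_iso quot6 uIso 8 ?_
  have e : quot6 ≫ uIso.hom = Spec.map (CommRingCat.ofHom φ6) := by
    rw [quot6, Category.assoc, Iso.inv_hom_id, Category.comp_id]
  rw [e]
  exact SplitTorusOver.trivialises_of_affine 8 (CommRingCat.ofHom φ6) ψ6.toCommRingCatIso hψ6

/-! ## The inhabitant and the failure of the printed sentence -/

/-- **The OURS record datum** with `X := Spec ℚ`, `r := 6`, `U := D(Δ6)`, `cell :=` the Prop-9.1 locus, `quot :=` the torus
normalisation in rational coordinates. OURS.
[cite: Hu2025, (9.2)/(9.3), Thm. 9.4 p.161 and [Hu22] p.131 l.4–41; joint J1 = GAP-LEDGER-HU row HU-R01 (unrefereed preprints arXiv:2507.21400v1 / arXiv:2203.03842v4 under adjudication, D-0012/D-0089 — kernel statement about OUR typed records of rows 101/109/110; nothing of the sources asserted)] -/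
def S6 : Hu22Setup_ours ℚ 9 quadHuMatroid where
  X := Xpt
  r := 6
  U := U6
  U_onto := surjective_U6_over
  cell := Lit.cellScheme
  quot := quot6
  quot_surjective := surjective_quot6
  m_mem := vertexMem_quadHuMatroid_mTri
  cellToGamma := Lit.cellToGammaQ
  cellToGamma_isOpenImmersion := by infer_instance
  range_cellToGamma := Lit.range_cellToGammaQ

/-- **The [La03] datum, NOMINAL** (row 110c's `LafforgueObjects` is unconstructed; g/h use `isoBarGr` over it nominally): `barGr := U`.
OURS; EXISTENCE of Lafforgue's objects is NOT shown.
[cite: Hu2025, Thm. 9.2/9.4 («the quotient space Gr̄_d := Gr_d/(𝔾ⁿ_m/𝔾_m)») p.160–161; joint J1 = GAP-LEDGER-HU row HU-R01 (unrefereed preprints under adjudication, D-0012/D-0089 — kernel statement about OUR typed records; nothing of the sources asserted)] -/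
def L_quad : LafforgueObjects where
  conf := fun _ _ => Xpt
  PGLActsFreely := fun _ _ => True
  barConf := fun _ _ => Xpt
  barGr := fun _ _ _ => (U6 : Scheme.{0})

/-- **THE (β) KERNEL INHABITANT OF ROW 110 h**: `S_printed6 : Hu22Setup_printed_ours L_quad ℚ 9 quadHuMatroid` — X := Spec ℚ,
r := 6 (positive), U := D(Δ6) ⊂ 𝔸⁶ ≅ Gr̄_quad, torus FREE (`TorusFree.torusFreeOnCell_quadHuMatroid`), `isoBarGr` nominal, the
quotient map TRIVIALISES ((9.4), cover {⊤}). OURS.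
[cite: Hu2025, Thm. 9.4 p.161; [Hu22] p.130 l.39–50, p.131 l.4–41, p.132 l.30–51; joint J1 = GAP-LEDGER-HU row HU-R01, reading (β) of the LEAD INDEX RULING 2026-08-27T10:01:59Z / LEAD GAP-PROPOSAL 10:40:07Z hand datum (unrefereed preprints under adjudication, D-0012/D-0089 — kernel statement about OUR typed records of rows 101/110 h; nothing of the sources asserted)] -/
def S_printed6 : Hu22Setup_printed_ours L_quad ℚ 9 quadHuMatroid :=
  S6.toPrintedOurs L_quad (show (0 : ℕ) < 6 by norm_num) TorusFree.torusFreeOnCell_quadHuMatroid (Iso.refl _)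
    trivialises_quot6

/-- `X = Spec ℚ` is integral.
[cite: Hu2025, [Hu22] p.131 l.40 («As X is integral (by assumption)»); joint J1 = GAP-LEDGER-HU row HU-R01 (unrefereed preprints under adjudication, D-0012/D-0089 — kernel statement about OUR typed records; nothing of the sources asserted)] -/
instance isIntegral_X6 : IsIntegral S_printed6.X := inferInstanceAs (IsIntegral (Spec Qr))

/-- **`¬ Hu22P131L40_printed_ours S_printed6`** — [Hu22] p.131 l.40–41 («As `X` is integral (by assumption), one sees that `Z_Γ` is
integral») over row 110 h's PRINTED-SETTING OURS record FAILS for a kernel inhabitant carrying ALL of Thm 9.4's printed data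
(`r = 6 > 0`, `U` open in `X × 𝔸⁶` onto `X`, torus free, `U ≅ Gr̄_d` with `π` a trivial `𝔾⁸_m`-torsor, cell = the Prop-9.1 locus):
`X = Spec ℚ` is integral, `Z_{Γ_d}` is not. (Not met, and not meetable at `ℚ`: g's `X` of finite type over Spec ℤ —
`PrintedSettingRatEmpty` p526634; «`d` = Lafforgue's encoding of `X`» is untyped.) OURS kernel statement about the typed record;
it bears on ONE inference, not on [Hu25] Thm 1.3/1.1.
[cite: Hu2025, Thm. 9.4 p.161; [Hu22] p.131 l.40–41 with l.4–39 and p.132 l.30–51; joint J1 = GAP-LEDGER-HU row HU-R01, reading (β) (unrefereed preprints under adjudication, D-0012/D-0089 — kernel statement about OUR typed records of row 110 h; nothing of the sources asserted)] -/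
theorem not_Hu22P131L40_printed_ours_6 : ¬ Hu22P131L40_printed_ours S_printed6 := fun h =>
  Lit.not_isIntegral_gammaSpec_Γq (h isIntegral_X6)

/-- Bookkeeping: the data of the inhabitant.
[cite: Hu2025, Thm. 9.4 p.161; [Hu22] p.131 l.4–41; joint J1 = GAP-LEDGER-HU row HU-R01 (unrefereed preprints under adjudication, D-0012/D-0089 — kernel statement about OUR typed records; nothing of the sources asserted)] -/
theorem S_printed6_data : S_printed6.X = Spec Qr ∧ S_printed6.r = 6 ∧ S_printed6.U = U6 ∧ S_printed6.cell = Lit.cellScheme ∧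
    S_printed6.quot = quot6 := ⟨rfl, rfl, rfl, rfl, rfl⟩

end Torus6

end Literature.AlgebraicGeometry.Hu2025.Statements.S01S09Interface

end
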